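import Summits.Ventures.LatticeQCDFlow.Scoring.OnePlaquetteSU3Moments
import Summits.Ventures.LatticeQCDFlow.Scoring.OnePlaquetteEnclosures
import HarnessLib

/-!
# Kernel-checked enclosures of the SU(3) one-plaquette plaquette `⟨(1/3) Re tr U_p⟩_β` at `β = 4, 5, 6`

HONEST FRAMING: exact (Metropolis-corrected) sampling algorithms for lattice gauge theory;
figures of merit are autocorrelation/cost numbers at stated couplings and volumes; no
continuum-physics claim.

Venture `LatticeQCDFlow` (cell pub-lqcd), sub-topic `Scoring`; FANOUT row 5 (`s0-sun-a`, S0-C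
implementation A — the 'exact 2-d plaquette oracle' column).  NEW WORK of the cell (placement rule);
completes `Scoring/OnePlaquetteEnclosures.lean` (U(1) / SU(2) keys) with the three SU(3) keys of the
frozen scorers' reference table (`reference_table v0.3` = X02: `su3 | 2 | wilson | periodic | β | L`,
`β = 4.0, 5.0, 6.0`, `L = 8, 16`):

* `onePlaquetteExpectSU3_encl_4` — `0.279619149409 ≤ ⟨(1/3) Re tr U⟩₄ ≤ 0.279619149410`,
* `onePlaquetteExpectSU3_encl_5` — `0.353954436705 ≤ ⟨(1/3) Re tr U⟩₅ ≤ 0.353954436706`,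
* `onePlaquetteExpectSU3_encl_6` — `0.422531739649 ≤ ⟨(1/3) Re tr U⟩₆ ≤ 0.422531739650`,

for the Weyl-torus one-plaquette expectation `onePlaquetteExpectSU3 β plaqSU3` of
`Scoring/OnePlaquetteSU3.lean` (the infinite-volume 2-d SU(3) Wilson plaquette; exact values
`0.27961914940930440…`, `0.35395443670527054…`, `0.42253173964998346…`).  The X02 torus values of
record at `16²` AND at `8²` differ from the infinite-volume value by less than `10⁻²⁴` (row 5
ORACLE-TABLE-S0-C-A.md, 74-digit character expansion), so all six SU(3) reference-table plaquettes lie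
inside these width-`10⁻¹²` enclosures.

Method.  Writing `x = β/3`, `E = Re tr U`, `F = 1 + E` (`|F| ≤ 4`): `e^{xE} = e^{−x} e^{xF}`, the
exponential Taylor remainder with geometric tail (`abs_exp_sub_sum_le`, `|xF| ≤ 4x`, `2·4x ≤ K+1`), the
exact rational moments `∫∫ |Δ|² F^k = (2π)² su3Moment k` / `∫∫ (E/3)|Δ|² F^k = (2π)² (su3Moment(k+1) −
su3Moment k)/3` of `Scoring/OnePlaquetteSU3Moments.lean` and `∫∫ |Δ|² = 6 (2π)²` give
`|N − L n| ≤ L t`, `|Z − L z| ≤ L t` with `L = 6 e^{−x} (2π)²`, `t = 2(4x)^K/K!`, rational `n, z`;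
`div_mem_of_abs_sub_le` turns seven rational inequalities into the enclosure.  The moments are evaluated
in the kernel by a list form of `T_k(a,b) = Σ_s C(k,s)C(k,s−a)C(k,s−b)` (Pascal row by the
multiplicative recurrence, three aligned traversals; `Tn_eq_tripleBinom`), `K = 32 / 36 / 42` terms,
closed by `decide +kernel` (exact rational arithmetic, no floating point).
-/

namespace Summit.Ventures.LatticeQCDFlow.Scoring

open MeasureTheory intervalIntegral Finset
open scoped Real Nat

/-! ### 1. Truncating the double integral -/

/-- **2-d truncation bound, `F`-form.**  For a jointly continuous weight `|w| ≤ 1` with moments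
`∫∫ w |Δ|² (1 + Re tr U)^k = (2π)² μ_k`, `0 ≤ x` and `2(4x) ≤ K + 1`:
`|∫∫ w |Δ|² e^{x(1 + Re tr U)} − (2π)² Σ_{k<K} x^k μ_k/k!| ≤ (2π)² · 6 · 2(4x)^K/K!`. -/
theorem abs_integral2_weight_expF_sub_le {w : ℝ → ℝ → ℝ} (hw : Continuous fun p : ℝ × ℝ => w p.1 p.2)
    (hw1 : ∀ θ₁ θ₂, |w θ₁ θ₂| ≤ 1) {μ : ℕ → ℚ}
    (hm : ∀ k : ℕ, (∫ θ₁ in (0 : ℝ)..2 * π, ∫ θ₂ in (0 : ℝ)..2 * π,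
        w θ₁ θ₂ * (weylSU3 θ₁ θ₂ * (1 + reTrSU3 θ₁ θ₂) ^ k)) = (2 * π) ^ 2 * ((μ k : ℚ) : ℝ))
    {x : ℝ} (hx : 0 ≤ x) {K : ℕ} (hK : 2 * (4 * x) ≤ K + 1) :
    |(∫ θ₁ in (0 : ℝ)..2 * π, ∫ θ₂ in (0 : ℝ)..2 * π,
        w θ₁ θ₂ * (weylSU3 θ₁ θ₂ * Real.exp (x * (1 + reTrSU3 θ₁ θ₂))))
      - (2 * π) ^ 2 * ∑ k ∈ range K, x ^ k / (k ! : ℝ) * ((μ k : ℚ) : ℝ)|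
      ≤ (2 * π) ^ 2 * (6 * (2 * (4 * x) ^ K / (K ! : ℝ))) := by
  have hsum : (2 * π) ^ 2 * ∑ k ∈ range K, x ^ k / (k ! : ℝ) * ((μ k : ℚ) : ℝ)
      = ∫ θ₁ in (0 : ℝ)..2 * π, ∫ θ₂ in (0 : ℝ)..2 * π, ∑ k ∈ range K,
          x ^ k / (k ! : ℝ) * (w θ₁ θ₂ * (weylSU3 θ₁ θ₂ * (1 + reTrSU3 θ₁ θ₂) ^ k)) := by
    rw [integral2_finset_sum _ (fun k _ => by fun_prop), Finset.mul_sum]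
    refine Finset.sum_congr rfl fun k _ => ?_
    rw [integral2_const_mul, hm k]
    ring
  have hpt : ∀ θ₁ θ₂ : ℝ, w θ₁ θ₂ * (weylSU3 θ₁ θ₂ * Real.exp (x * (1 + reTrSU3 θ₁ θ₂)))
      - ∑ k ∈ range K, x ^ k / (k ! : ℝ) * (w θ₁ θ₂ * (weylSU3 θ₁ θ₂ * (1 + reTrSU3 θ₁ θ₂) ^ k))
      = (w θ₁ θ₂ * weylSU3 θ₁ θ₂) * (Real.exp (x * (1 + reTrSU3 θ₁ θ₂))
          - ∑ k ∈ range K, (x * (1 + reTrSU3 θ₁ θ₂)) ^ k / (k ! : ℝ)) := by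
    intro θ₁ θ₂
    simp only [mul_sub, Finset.mul_sum]
    congr 1
    · ring
    · refine Finset.sum_congr rfl fun k _ => ?_
      rw [mul_pow]
      ring
  rw [hsum, ← integral2_sub (by fun_prop) (by fun_prop)]
  simp_rw [hpt]
  have hB : ∀ θ₁ θ₂ : ℝ, ‖(w θ₁ θ₂ * weylSU3 θ₁ θ₂) * (Real.exp (x * (1 + reTrSU3 θ₁ θ₂))
      - ∑ k ∈ range K, (x * (1 + reTrSU3 θ₁ θ₂)) ^ k / (k ! : ℝ))‖
        ≤ 2 * (4 * x) ^ K / (K ! : ℝ) * weylSU3 θ₁ θ₂ := by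
    intro θ₁ θ₂
    rw [Real.norm_eq_abs, abs_mul, abs_mul, abs_of_nonneg (weylSU3_nonneg θ₁ θ₂)]
    have hxF : |x * (1 + reTrSU3 θ₁ θ₂)| ≤ 4 * x := by
      rw [abs_mul, abs_of_nonneg hx]
      calc x * |1 + reTrSU3 θ₁ θ₂| ≤ x * 4 :=
            mul_le_mul_of_nonneg_left (abs_one_add_reTrSU3_le θ₁ θ₂) hx
        _ = 4 * x := by ring
    have hT := abs_exp_sub_sum_le hxF hK
    have hV := weylSU3_nonneg θ₁ θ₂
    calc |w θ₁ θ₂| * weylSU3 θ₁ θ₂ * |Real.exp (x * (1 + reTrSU3 θ₁ θ₂))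
          - ∑ k ∈ range K, (x * (1 + reTrSU3 θ₁ θ₂)) ^ k / (k ! : ℝ)|
        ≤ 1 * weylSU3 θ₁ θ₂ * (2 * (4 * x) ^ K / (K ! : ℝ)) := by
          gcongr
          exact hw1 θ₁ θ₂
      _ = 2 * (4 * x) ^ K / (K ! : ℝ) * weylSU3 θ₁ θ₂ := by ring
  have h := norm_integral2_le (g := fun θ₁ θ₂ => (w θ₁ θ₂ * weylSU3 θ₁ θ₂)
      * (Real.exp (x * (1 + reTrSU3 θ₁ θ₂)) - ∑ k ∈ range K, (x * (1 + reTrSU3 θ₁ θ₂)) ^ k / (k ! : ℝ)))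
    (B := fun θ₁ θ₂ => 2 * (4 * x) ^ K / (K ! : ℝ) * weylSU3 θ₁ θ₂) (by fun_prop) hB
    (by positivity : (0 : ℝ) ≤ 2 * π) (by positivity : (0 : ℝ) ≤ 2 * π)
  rw [Real.norm_eq_abs, integral2_const_mul, integral2_weylSU3] at h
  calc _ ≤ 2 * (4 * x) ^ K / (K ! : ℝ) * ((2 * π) ^ 2 * 6) := h
    _ = (2 * π) ^ 2 * (6 * (2 * (4 * x) ^ K / (K ! : ℝ))) := by ring

/-- **2-d truncation bound** for the Wilson weight `e^{x Re tr U}` (`x = β/3`): with `L = 6 e^{−x} (2π)²`,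
`|∫∫ w |Δ|² e^{x Re tr U} − L · (Σ_{k<K} x^k μ_k/k!)/6| ≤ L · 2(4x)^K/K!`. -/
theorem abs_integral2_weight_exp_sub_le {w : ℝ → ℝ → ℝ} (hw : Continuous fun p : ℝ × ℝ => w p.1 p.2)
    (hw1 : ∀ θ₁ θ₂, |w θ₁ θ₂| ≤ 1) {μ : ℕ → ℚ}
    (hm : ∀ k : ℕ, (∫ θ₁ in (0 : ℝ)..2 * π, ∫ θ₂ in (0 : ℝ)..2 * π,
        w θ₁ θ₂ * (weylSU3 θ₁ θ₂ * (1 + reTrSU3 θ₁ θ₂) ^ k)) = (2 * π) ^ 2 * ((μ k : ℚ) : ℝ))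
    {x : ℝ} (hx : 0 ≤ x) {K : ℕ} (hK : 2 * (4 * x) ≤ K + 1) :
    |(∫ θ₁ in (0 : ℝ)..2 * π, ∫ θ₂ in (0 : ℝ)..2 * π,
        w θ₁ θ₂ * (weylSU3 θ₁ θ₂ * Real.exp (x * reTrSU3 θ₁ θ₂)))
      - (6 * Real.exp (-x) * (2 * π) ^ 2)
        * ((∑ k ∈ range K, x ^ k / (k ! : ℝ) * ((μ k : ℚ) : ℝ)) / 6)|
      ≤ (6 * Real.exp (-x) * (2 * π) ^ 2) * (2 * (4 * x) ^ K / (K ! : ℝ)) := by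
  have hpt : ∀ θ₁ θ₂ : ℝ, w θ₁ θ₂ * (weylSU3 θ₁ θ₂ * Real.exp (x * reTrSU3 θ₁ θ₂))
      = Real.exp (-x) * (w θ₁ θ₂ * (weylSU3 θ₁ θ₂ * Real.exp (x * (1 + reTrSU3 θ₁ θ₂)))) := by
    intro θ₁ θ₂
    have : Real.exp (x * reTrSU3 θ₁ θ₂) = Real.exp (-x) * Real.exp (x * (1 + reTrSU3 θ₁ θ₂)) := by
      rw [← Real.exp_add]
      congr 1
      ring
    rw [this]
    ring
  simp_rw [hpt]
  rw [integral2_const_mul]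
  have key := abs_integral2_weight_expF_sub_le hw hw1 hm hx hK
  set I := ∫ θ₁ in (0 : ℝ)..2 * π, ∫ θ₂ in (0 : ℝ)..2 * π,
      w θ₁ θ₂ * (weylSU3 θ₁ θ₂ * Real.exp (x * (1 + reTrSU3 θ₁ θ₂))) with hI
  set S := ∑ k ∈ range K, x ^ k / (k ! : ℝ) * ((μ k : ℚ) : ℝ) with hS
  have e1 : Real.exp (-x) * I - 6 * Real.exp (-x) * (2 * π) ^ 2 * (S / 6)
      = Real.exp (-x) * (I - (2 * π) ^ 2 * S) := by ring
  rw [e1, abs_mul, abs_of_pos (Real.exp_pos _)]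
  calc Real.exp (-x) * |I - (2 * π) ^ 2 * S|
      ≤ Real.exp (-x) * ((2 * π) ^ 2 * (6 * (2 * (4 * x) ^ K / (K ! : ℝ)))) :=
        mul_le_mul_of_nonneg_left key (Real.exp_pos _).le
    _ = 6 * Real.exp (-x) * (2 * π) ^ 2 * (2 * (4 * x) ^ K / (K ! : ℝ)) := by ring

/-! ### 2. Kernel-friendly evaluation of `T_k(a, b)` and of `su3Moment k` -/

/-- Pascal row `k` from position `s` on (`n` entries) by the multiplicative recurrence
`C(k,s+1) = C(k,s)(k−s)/(s+1)`; `c` is the current entry `C(k,s)`. -/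
def binomRowAux (k : ℕ) : ℕ → ℕ → ℕ → List ℕ
  | 0, _, _ => []
  | n + 1, s, c => c :: binomRowAux k n (s + 1) (c * (k - s) / (s + 1))

/-- Pascal row `k`: `[C(k,0), …, C(k,k)]`. -/
def binomRow (k : ℕ) : List ℕ := binomRowAux k (k + 1) 0 1

/-- Pascal row `k` behind four zeros (so that index `j` holds `C(k, j − 4)`, zero-extended). -/
def padRow (k : ℕ) : List ℕ := 0 :: 0 :: 0 :: 0 :: binomRow k

/-- Sum of termwise triple products of three lists (truncated at the shortest). -/
def dot3 : List ℕ → List ℕ → List ℕ → ℕ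
  | x :: xs, y :: ys, z :: zs => x * y * z + dot3 xs ys zs
  | _, _, _ => 0

/-- `Tn k da db = Σ_i C(k,i) C(k,i+da−4) C(k,i+db−4) = T_k(4−da, 4−db)` by aligned list traversals. -/
def Tn (k da db : ℕ) : ℕ := dot3 (binomRow k) ((padRow k).drop da) ((padRow k).drop db)

/-- The recurrence reproduces the binomial coefficients: started at `C(k,s)` it lists `C(k,s), …, C(k,s+n−1)`. -/
theorem binomRowAux_eq (k : ℕ) :
    ∀ n s : ℕ, binomRowAux k n s (k.choose s) = (List.range' s n).map k.choose
  | 0, s => by simp [binomRowAux]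
  | n + 1, s => by
      have hc : k.choose s * (k - s) / (s + 1) = k.choose (s + 1) := by
        rw [← Nat.choose_succ_right_eq, Nat.mul_div_cancel _ (Nat.succ_pos s)]
      show k.choose s :: binomRowAux k n (s + 1) (k.choose s * (k - s) / (s + 1))
        = k.choose s :: (List.range' (s + 1) n).map k.choose
      rw [hc, binomRowAux_eq k n (s + 1)]

/-- `binomRow k = [C(k,0), …, C(k,k)]`. -/
theorem binomRow_eq (k : ℕ) : binomRow k = (List.range (k + 1)).map k.choose := by
  have h : binomRow k = binomRowAux k (k + 1) 0 (k.choose 0) := by rw [Nat.choose_zero_right]; rfl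
  rw [h, binomRowAux_eq, List.range_eq_range']

/-- Zero-extended indexing of the Pascal row. -/
theorem binomRow_getD (k i : ℕ) : (binomRow k).getD i 0 = k.choose i := by
  rw [binomRow_eq, List.getD_eq_getElem?_getD, List.getElem?_map]
  by_cases hi : i < k + 1
  · rw [List.getElem?_range hi]
    simp
  · rw [List.getElem?_eq_none (by simp; omega)]
    simp [Nat.choose_eq_zero_of_lt (by omega : k < i)]

/-- The length of the Pascal row. -/
theorem binomRow_length (k : ℕ) : (binomRow k).length = k + 1 := by
  simp [binomRow_eq]

/-- Index `j` of the padded row holds `C(k, j − 4)` (zero-extended). -/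
theorem padRow_getD (k j : ℕ) : (padRow k).getD j 0 = zchoose k ((j : ℤ) - 4) := by
  unfold padRow zchoose
  match j with
  | 0 => simp
  | 1 => simp
  | 2 => simp
  | 3 => simp
  | j + 4 =>
      simp only [List.getD_cons_succ, binomRow_getD]
      have h1 : ¬ ((((j + 4 : ℕ) : ℤ)) - 4 < 0) := by omega
      have h2 : ((((j + 4 : ℕ) : ℤ)) - 4).toNat = j := by omega
      rw [if_neg h1, h2]

/-- `dot3` as an indexed sum over the first list. -/
theorem dot3_eq_sum : ∀ l₁ l₂ l₃ : List ℕ,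
    dot3 l₁ l₂ l₃ = ∑ i ∈ range l₁.length, l₁.getD i 0 * l₂.getD i 0 * l₃.getD i 0
  | [], _, _ => by simp [dot3]
  | x :: xs, [], l₃ => by simp [dot3]
  | x :: xs, y :: ys, [] => by simp [dot3]
  | x :: xs, y :: ys, z :: zs => by
      rw [dot3, dot3_eq_sum xs ys zs, List.length_cons, Finset.sum_range_succ']
      simp only [List.getD_cons_succ, List.getD_cons_zero]
      ring

/-- **The list evaluation is the triple binomial sum**: `Tn k da db = T_k(4 − da, 4 − db)`. -/
theorem Tn_eq_tripleBinom (k da db : ℕ) : Tn k da db = tripleBinom k (4 - (da : ℤ)) (4 - (db : ℤ)) := by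
  unfold Tn tripleBinom
  rw [dot3_eq_sum, binomRow_length]
  refine Finset.sum_congr rfl fun i _ => ?_
  have hd : ∀ d : ℕ, ((padRow k).drop d).getD i 0 = (padRow k).getD (d + i) 0 := fun d => by
    simp [List.getD_eq_getElem?_getD, List.getElem?_drop]
  rw [binomRow_getD, hd, hd, padRow_getD, padRow_getD]
  congr 2 <;> push_cast <;> ring

/-- The table exponents are at most `4`. -/
theorem su3wA_le (i : ℕ) : su3wA i ≤ 4 := by
  unfold su3wA; split <;> decide

/-- The table exponents are at most `4`. -/
theorem su3wB_le (i : ℕ) : su3wB i ≤ 4 := by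
  unfold su3wB; split <;> decide

/-- Kernel-friendly `Σ_{i<n} c_i T_k(a_i, b_i)` (structural recursion). -/
def su3MomentSum (k : ℕ) : ℕ → ℤ
  | 0 => 0
  | i + 1 => su3MomentSum k i + su3wC i * (Tn k (4 - su3wA i).toNat (4 - su3wB i).toNat : ℤ)

/-- Kernel-friendly form of `su3Moment k`. -/
def su3MomentFast (k : ℕ) : ℚ := (su3MomentSum k 19 : ℚ) / 2 ^ k

/-- `su3MomentSum k n = Σ_{i<n} c_i T_k(a_i, b_i)`. -/
theorem su3MomentSum_eq (k : ℕ) : ∀ n : ℕ, (su3MomentSum k n : ℚ)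
    = ∑ i ∈ range n, (su3wC i : ℚ) * (tripleBinom k (su3wA i) (su3wB i) : ℚ)
  | 0 => by simp [su3MomentSum]
  | n + 1 => by
      rw [su3MomentSum, Finset.sum_range_succ, ← su3MomentSum_eq k n, Tn_eq_tripleBinom,
        Int.toNat_of_nonneg (by have := su3wA_le n; omega),
        Int.toNat_of_nonneg (by have := su3wB_le n; omega), sub_sub_cancel, sub_sub_cancel]
      push_cast
      ring

/-- `su3MomentFast = su3Moment`. -/
theorem su3MomentFast_eq (k : ℕ) : su3MomentFast k = su3Moment k := by
  unfold su3MomentFast su3Moment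
  rw [su3MomentSum_eq]

/-! ### 3. The rational certificate checker and its soundness -/

/-- `z_K = Σ_{k<K} x^k su3Moment k / k!`. -/
def su3Zsum (x : ℚ) (K : ℕ) : ℚ := psumQ (fun k => x ^ k / k ! * su3MomentFast k) K

/-- `n_K = Σ_{k<K} x^k (su3Moment (k+1) − su3Moment k)/(3 k!)`. -/
def su3Nsum (x : ℚ) (K : ℕ) : ℚ :=
  psumQ (fun k => x ^ k / k ! * ((su3MomentFast (k + 1) - su3MomentFast k) / 3)) K

/-- SU(3) certificate checker for `lo ≤ ⟨(1/3) Re tr U⟩_β ≤ hi` with `K` Taylor terms: the seven rational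
inequalities of `div_mem_of_abs_sub_le` with tail variable `4β/3` and the sums scaled by `1/6`. -/
def su3Check (β lo hi : ℚ) (K : ℕ) : Bool :=
  ratioCheck (4 * (β / 3)) (su3Nsum (β / 3) K / 6) (su3Zsum (β / 3) K / 6) lo hi K

/-- **Soundness of the SU(3) checker**: `su3Check β lo hi K = true` implies
`lo ≤ onePlaquetteExpectSU3 β plaqSU3 ≤ hi`. -/
theorem su3Check_sound {β lo hi : ℚ} {K : ℕ} (h : su3Check β lo hi K = true) :
    ((lo : ℚ) : ℝ) ≤ onePlaquetteExpectSU3 ((β : ℚ) : ℝ) plaqSU3 ∧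
      onePlaquetteExpectSU3 ((β : ℚ) : ℝ) plaqSU3 ≤ ((hi : ℚ) : ℝ) := by
  obtain ⟨hβ, hK, hlo0, htz, htn, hlo, hhi⟩ := ratioCheck_spec h
  have hx : (0 : ℝ) ≤ ((β : ℚ) : ℝ) / 3 := by
    have : (0 : ℚ) ≤ β := by linarith
    have : (0 : ℝ) ≤ ((β : ℚ) : ℝ) := by exact_mod_cast this
    linarith
  have hK' : 2 * (4 * (((β : ℚ) : ℝ) / 3)) ≤ (K : ℝ) + 1 := by exact_mod_cast hK
  have hN := abs_integral2_weight_exp_sub_le (w := plaqSU3) (by fun_prop) abs_plaqSU3_le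
    (μ := fun k => (su3Moment (k + 1) - su3Moment k) / 3)
    (fun k => integral2_plaqSU3_weylSU3_mul_pow k) hx hK'
  have hZ := abs_integral2_weight_exp_sub_le (w := fun _ _ => (1 : ℝ)) (by fun_prop)
    (fun _ _ => by simp) (μ := su3Moment)
    (fun k => by simpa only [one_mul] using integral2_weylSU3_mul_pow k) hx hK'
  simp only [one_mul] at hZ
  have ez : ((su3Zsum (β / 3) K / 6 : ℚ) : ℝ)
      = (∑ k ∈ range K, (((β : ℚ) : ℝ) / 3) ^ k / (k ! : ℝ) * ((su3Moment k : ℚ) : ℝ)) / 6 := by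
    rw [su3Zsum, psumQ_eq_sum]
    simp_rw [su3MomentFast_eq]
    push_cast
    rfl
  have en : ((su3Nsum (β / 3) K / 6 : ℚ) : ℝ)
      = (∑ k ∈ range K, (((β : ℚ) : ℝ) / 3) ^ k / (k ! : ℝ)
          * (((su3Moment (k + 1) - su3Moment k) / 3 : ℚ) : ℝ)) / 6 := by
    rw [su3Nsum, psumQ_eq_sum]
    simp_rw [su3MomentFast_eq]
    push_cast
    rfl
  have et : ((expTail (4 * (β / 3)) K : ℚ) : ℝ) = 2 * (4 * (((β : ℚ) : ℝ) / 3)) ^ K / (K ! : ℝ) := by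
    rw [expTail]
    push_cast
    rfl
  rw [← ez] at hZ
  rw [← en] at hN
  rw [← et] at hZ hN
  unfold onePlaquetteExpectSU3 onePlaquetteZSU3
  exact div_mem_of_abs_sub_le (by positivity) hN hZ (by exact_mod_cast hlo0) (by exact_mod_cast htz)
    (by exact_mod_cast htn) (by exact_mod_cast hlo) (by exact_mod_cast hhi)

/-! ### 4. The three enclosures (width `10⁻¹²`; `decide +kernel` evaluates the rational checker) -/

/-- **SU(3), `β = 4.0`**: `0.279619149409 ≤ ⟨(1/3) Re tr U⟩₄ ≤ 0.279619149410`
(exact `0.27961914940930440…`; the X02 `8²`/`16²` torus values of record differ from it by `< 10⁻³⁵`). -/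
theorem onePlaquetteExpectSU3_encl_4 :
    (279619149409 : ℝ) / 1000000000000 ≤ onePlaquetteExpectSU3 4 plaqSU3 ∧
      onePlaquetteExpectSU3 4 plaqSU3 ≤ (279619149410 : ℝ) / 1000000000000 := by
  have h := su3Check_sound (β := 4) (lo := 279619149409 / 1000000000000)
    (hi := 279619149410 / 1000000000000) (K := 32) (by decide +kernel)
  push_cast at h
  exact h

/-- **SU(3), `β = 5.0`** (row 5's S0-C-05 point): `0.353954436705 ≤ ⟨(1/3) Re tr U⟩₅ ≤ 0.353954436706`
(exact `0.35395443670527054…`; torus corrections `< 10⁻²⁹`). -/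
theorem onePlaquetteExpectSU3_encl_5 :
    (353954436705 : ℝ) / 1000000000000 ≤ onePlaquetteExpectSU3 5 plaqSU3 ∧
      onePlaquetteExpectSU3 5 plaqSU3 ≤ (353954436706 : ℝ) / 1000000000000 := by
  have h := su3Check_sound (β := 5) (lo := 353954436705 / 1000000000000)
    (hi := 353954436706 / 1000000000000) (K := 36) (by decide +kernel)
  push_cast at h
  exact h

/-- **SU(3), `β = 6.0`**: `0.422531739649 ≤ ⟨(1/3) Re tr U⟩₆ ≤ 0.422531739650`
(exact `0.42253173964998346…`; torus corrections `< 10⁻²⁴`). -/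
theorem onePlaquetteExpectSU3_encl_6 :
    (422531739649 : ℝ) / 1000000000000 ≤ onePlaquetteExpectSU3 6 plaqSU3 ∧
      onePlaquetteExpectSU3 6 plaqSU3 ≤ (422531739650 : ℝ) / 1000000000000 := by
  have h := su3Check_sound (β := 6) (lo := 422531739649 / 1000000000000)
    (hi := 422531739650 / 1000000000000) (K := 42) (by decide +kernel)
  push_cast at h
  exact h

end Summit.Ventures.LatticeQCDFlow.Scoring
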